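import Literature.AlgebraicGeometry.Resolution.LogRegularEtaleResolutionHolds
import Summits.ResolutionOfSingularities.ResolutionOfSingularities.Theorems.CleanCoversCoverResolutionSplitConverse
import HarnessLib

/-!
# `CoverResolution`: the log regular piece of the split is PROVED (Nizioł 2006, Cor. 5.7)

Crux `CleanCovers.CoverResolution` (stmt-ResolutionOfSingularities-15104). The split
`coverResolution_of_subs` (p. `CleanCoversCoverResolutionSplit`) reduces the crux to three pieces:
P1 local log regular models along the boundary, P3 patching, and P2 `LogRegularResolution` —
resolution of quasi-compact log regular schemes with étale charts, which is the universe-`0`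
instance of the named fact `Niziol2006_logRegularScheme_hasResolution`
(`logRegularResolution_iff_niziol2006`). That fact is now a theorem of the tree
(`Literature.AlgebraicGeometry.Resolution.Niziol2006_logRegularScheme_hasResolution_holds`, ÉTALE
KATO programme: Kato 1994 (10.4) on étale charts + effective descent of the centre + regularity
descent along the flat cover). Hence:

* `logRegularResolution_holds` — P2 unconditionally;
* `coverResolution_of_local_and_patching` — the crux follows from P1 and P3 alone;
* `coverResolution_iff_local_and_patching_holds` — and is equivalent to `P1 ∧ P3`.
-/

namespace Summit.ResolutionOfSingularities.ResolutionOfSingularities.Theorems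

open CategoryTheory AlgebraicGeometry
open Summit.ResolutionOfSingularities.ResolutionOfSingularities.Theses
open Summit.ResolutionOfSingularities.ResolutionOfSingularities.Theses.CleanCovers

/-- **P2 `LogRegularResolution` holds**: every quasi-compact scheme which is log regular for an fs
log structure with étale charts admits a resolution of singularities (Nizioł 2006, Cor. 5.7, weak
form; the tree's theorem `Niziol2006_logRegularScheme_hasResolution_holds` through
`logRegularResolution_iff_niziol2006`). [cite: Niziol2006, Cor. 5.7] -/
theorem logRegularResolution_holds :
    ∀ (Y : AlgebraicGeometry.Scheme.{0}), CompactSpace Y →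
      Literature.AlgebraicGeometry.Resolution.Scheme.IsLogRegularEtale Y →
        Literature.AlgebraicGeometry.Resolution.Scheme.HasResolution Y :=
  logRegularResolution_iff_niziol2006.2
    Literature.AlgebraicGeometry.Resolution.Niziol2006_logRegularScheme_hasResolution_holds

/-- **The crux `CoverResolution` follows from its two open children alone** — P1 (local log regular
models of the cover along the hyperplane at infinity) and P3 (patching of log regular models over a
union of two opens): the third input of `coverResolution_of_subs`, resolution of log regular
schemes, is `logRegularResolution_holds`. [cite: Niziol2006, Cor. 5.7] -/
theorem coverResolution_of_local_and_patching :
    (∀ p : ℕ, p.Prime → ∀ (k : Type) [Field k] [CharP k p] [PerfectField k] (n : ℕ) (X : AlgebraicGeometry.Scheme.{0}) (f : X ⟶ (Literature.AlgebraicGeometry.Motives.projectiveSpace n k).left), AlgebraicGeometry.IsIntegral X → AlgebraicGeometry.IsFinite f → Function.Surjective f.base → (letI := MvPolynomial.gradedAlgebra (σ := Fin (n + 1)) (R := k); AlgebraicGeometry.Etale (f ∣_ (AlgebraicGeometry.Proj.basicOpen (MvPolynomial.homogeneousSubmodule (Fin (n + 1)) k) (MvPolynomial.X (Fin.last n)))))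 → ∀ h : (Literature.AlgebraicGeometry.Motives.projectiveSpace n k).left, (letI := MvPolynomial.gradedAlgebra (σ := Fin (n + 1)) (R := k); h ∉ AlgebraicGeometry.Proj.basicOpen (MvPolynomial.homogeneousSubmodule (Fin (n + 1)) k) (MvPolynomial.X (Fin.last n))) → ∃ B : (Literature.AlgebraicGeometry.Motives.projectiveSpace n k).left.Opens, h ∈ B ∧ ∃ (Y : AlgebraicGeometry.Scheme.{0}) (π : Y ⟶ ((f ⁻¹ᵁ B : X.Opens) : AlgebraicGeometry.Scheme.{0})), AlgebraicGeometry.IsProper π ∧ Literature.AlgebraicGeometry.Resolution.IsBirational π ∧ Literature.AlgebraicGeometry.Resolution.Scheme.IsLogRegularEtale Y) →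
    (∀ p : ℕ, p.Prime → ∀ (k : Type) [Field k] [CharP k p] [PerfectField k] (n : ℕ) (X : AlgebraicGeometry.Scheme.{0}) (f : X ⟶ (Literature.AlgebraicGeometry.Motives.projectiveSpace n k).left), AlgebraicGeometry.IsIntegral X → AlgebraicGeometry.IsFinite f → Function.Surjective f.base → (letI := MvPolynomial.gradedAlgebra (σ := Fin (n + 1)) (R := k); AlgebraicGeometry.Etale (f ∣_ (AlgebraicGeometry.Proj.basicOpen (MvPolynomial.homogeneousSubmodule (Fin (n + 1)) k) (MvPolynomial.X (Fin.last n))))) → ∀ B₁ B₂ : (Literature.AlgebraicGeometry.Motives.projectiveSpace n k).left.Opens, (∃ (Y : AlgebraicGeometry.Scheme.{0}) (π : Y ⟶ ((f ⁻¹ᵁ B₁ : X.Opens) : AlgebraicGeometry.Scheme.{0})), AlgebraicGeometry.IsProper π ∧ Literature.AlgebraicGeometry.Resolution.IsBirational π ∧ Literature.AlgebraicGeometry.Resolution.Scheme.IsLogRegularEtale Y) → (∃ (Y : AlgebraicGeometry.Scheme.{0}) (π : Y ⟶ ((f ⁻¹ᵁ B₂ : X.Opens) : AlgebraicGeometry.Scheme.{0})),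 AlgebraicGeometry.IsProper π ∧ Literature.AlgebraicGeometry.Resolution.IsBirational π ∧ Literature.AlgebraicGeometry.Resolution.Scheme.IsLogRegularEtale Y) → ∃ (Y : AlgebraicGeometry.Scheme.{0}) (π : Y ⟶ ((f ⁻¹ᵁ (B₁ ⊔ B₂) : X.Opens) : AlgebraicGeometry.Scheme.{0})), AlgebraicGeometry.IsProper π ∧ Literature.AlgebraicGeometry.Resolution.IsBirational π ∧ Literature.AlgebraicGeometry.Resolution.Scheme.IsLogRegularEtale Y) →
    CoverResolution :=
  fun hP1 hP3 => coverResolution_of_subs hP1 hP3 logRegularResolution_holds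

/-- **`CoverResolution ↔ P1 ∧ P3`** unconditionally (`coverResolution_iff_local_and_patching` with
P2 discharged). [cite: Niziol2006, Cor. 5.7] -/
theorem coverResolution_iff_local_and_patching_holds :
    CoverResolution ↔
      ((∀ p : ℕ, p.Prime → ∀ (k : Type) [Field k] [CharP k p] [PerfectField k] (n : ℕ) (X : AlgebraicGeometry.Scheme.{0}) (f : X ⟶ (Literature.AlgebraicGeometry.Motives.projectiveSpace n k).left), AlgebraicGeometry.IsIntegral X → AlgebraicGeometry.IsFinite f → Function.Surjective f.base → (letI := MvPolynomial.gradedAlgebra (σ := Fin (n + 1)) (R := k); AlgebraicGeometry.Etale (f ∣_ (AlgebraicGeometry.Proj.basicOpen (MvPolynomial.homogeneousSubmodule (Fin (n + 1)) k) (MvPolynomial.X (Fin.last n))))) → ∀ h : (Literature.AlgebraicGeometry.Motives.projectiveSpace n k).left, (letI := MvPolynomial.gradedAlgebra (σ := Fin (n + 1)) (R := k); h ∉ AlgebraicGeometry.Proj.basicOpen (MvPolynomial.homogeneousSubmodule (Fin (n + 1)) k) (MvPolynomial.X (Fin.last n))) → ∃ B : (Literature.AlgebraicGeometry.Motives.projectiveSpace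 n k).left.Opens, h ∈ B ∧ ∃ (Y : AlgebraicGeometry.Scheme.{0}) (π : Y ⟶ ((f ⁻¹ᵁ B : X.Opens) : AlgebraicGeometry.Scheme.{0})), AlgebraicGeometry.IsProper π ∧ Literature.AlgebraicGeometry.Resolution.IsBirational π ∧ Literature.AlgebraicGeometry.Resolution.Scheme.IsLogRegularEtale Y) ∧
       (∀ p : ℕ, p.Prime → ∀ (k : Type) [Field k] [CharP k p] [PerfectField k] (n : ℕ) (X : AlgebraicGeometry.Scheme.{0}) (f : X ⟶ (Literature.AlgebraicGeometry.Motives.projectiveSpace n k).left), AlgebraicGeometry.IsIntegral X → AlgebraicGeometry.IsFinite f → Function.Surjective f.base → (letI := MvPolynomial.gradedAlgebra (σ := Fin (n + 1)) (R := k); AlgebraicGeometry.Etale (f ∣_ (AlgebraicGeometry.Proj.basicOpen (MvPolynomial.homogeneousSubmodule (Fin (n + 1)) k) (MvPolynomial.X (Fin.last n))))) → ∀ B₁ B₂ : (Literature.AlgebraicGeometry.Motives.projectiveSpace n k).left.Opens, (∃ (Y : AlgebraicGeometry.Scheme.{0}) (π : Y ⟶ ((f ⁻¹ᵁ B₁ :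 X.Opens) : AlgebraicGeometry.Scheme.{0})), AlgebraicGeometry.IsProper π ∧ Literature.AlgebraicGeometry.Resolution.IsBirational π ∧ Literature.AlgebraicGeometry.Resolution.Scheme.IsLogRegularEtale Y) → (∃ (Y : AlgebraicGeometry.Scheme.{0}) (π : Y ⟶ ((f ⁻¹ᵁ B₂ : X.Opens) : AlgebraicGeometry.Scheme.{0})), AlgebraicGeometry.IsProper π ∧ Literature.AlgebraicGeometry.Resolution.IsBirational π ∧ Literature.AlgebraicGeometry.Resolution.Scheme.IsLogRegularEtale Y) → ∃ (Y : AlgebraicGeometry.Scheme.{0}) (π : Y ⟶ ((f ⁻¹ᵁ (B₁ ⊔ B₂) : X.Opens) : AlgebraicGeometry.Scheme.{0})), AlgebraicGeometry.IsProper π ∧ Literature.AlgebraicGeometry.Resolution.IsBirational π ∧ Literature.AlgebraicGeometry.Resolution.Scheme.IsLogRegularEtale Y)) :=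
  coverResolution_iff_local_and_patching logRegularResolution_holds

end Summit.ResolutionOfSingularities.ResolutionOfSingularities.Theorems
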